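import Summits.QuantumFields.YangMills.Theorems.AllWindowsColdBoxBulkMidHarmonicMaxPrincipleFluxDefs
import Summits.QuantumFields.YangMills.Theorems.AllWindowsColdBoxBulkMidKernelDipoleDecay
import Summits.QuantumFields.YangMills.Theorems.AllWindowsColdBoxBulkMidHarmonicFieldFormula
import Summits.QuantumFields.YangMills.Theorems.AllWindowsColdBoxBulkMidCollarExtension
import Summits.QuantumFields.YangMills.Theorems.AllWindowsColdBoxDirResponseL1OfDipoleDecay

/-!
# LINE-18 «BulkMidWindowSU2 birth v5» stub K3′ `stub_harmonicMaxPrincipleFlux`, BY NAME (crux `AllWindowsColdBox.BulkMidWindowSU2`,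
# ⟨stmt-QuantumFields-24006⟩; planner ym-idea-2 g14, skeleton sha16 `3c750a3750a2f49e`)

`DirHarmonicMaxPrincipleFlux` AS TYPED: for `H ≥ 1`, every datum `ϑ` and every `B` bounding `(sCirc (glue ϑ 0) q)²` over ALL plaquette keys `q` whose
four edges lie outside `dirFreeEdges H`, the circulation of the harmonic extension satisfies `F̄_p² ≤ c (1 + log H)⁴ B` at every key `p`.
Proof (three landed helpers of this seat + the line's K1):
* `F̄ = c − K·c` for the circulation vector `c` of ANY admissible competitor (✓`abs_dirBackground_le_abs_add_sum`, `…BulkMidHarmonicFieldFormula`);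
* under the typed hypothesis there is an admissible competitor with `|c| ≤ 12√B` everywhere (✓`exists_dirFree_sCirc_glue_abs_le`,
  `…BulkMidCollarExtension`: the keys straddling the outer boundary of the enlarged box pin the datum's shell VALUES, the corner keys pin the
  normal links at each boundary vertex up to one gauge value per vertex, the forest is a gauge);
* the K1 dipole law ✓`stub_kernelDipoleDecay` (`|K_{pq}| ≤ c₁(1+log H)/(1+‖p−q‖₁)⁴`) and the logarithmic lattice sum
  (`sum_inv_pow_four_plaquettes_le`, the tree's ✓`sum_cube_inv_pow_four_le_log`) give `Σ_q |K_{pq}| ≤ 16·321·c₁(1+log H)²`,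
so `|F̄_p| ≤ 12√B(1 + 5136 c₁)(1+log H)²` and `c = 144(1 + 5136c₁)²`.

HONEST LABEL (read before citing): this closes the REGISTERED text of K3′, which is WEAKER than the v4 memo's intended «flux max principle» — the
typed hypothesis is not gauge invariant (it reads shell potentials through the straddling keys), and the proof uses exactly that; the
gauge-invariant strengthening (hypothesis over the fully pinned plaquettes OF THE ENLARGED BOX only, conclusion over its plaquettes — the form
instrument I18c measured) is a different statement and remains OPEN.  No crux, rung or summit is proved; the Yang–Mills mass gap is NOT proved by
this file.
-/

set_option autoImplicit false

noncomputable section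

open Finset
open Literature.Probability.LatticeModels (Site halfOpenBox mem_halfOpenBox)
open Literature.MathematicalPhysics.QuantumFieldTheory
open Literature.MathematicalPhysics.QuantumFieldTheory.LatticeMaxwell
open Literature.MathematicalPhysics.QuantumFieldTheory.AxialGauge
open Summit.QuantumFields.YangMills.Theorems.WeakCouplingRates
open Summit.QuantumFields.YangMills.Theorems.AllWindowsColdBox.ShellSum
open Summit.QuantumFields.YangMills.Theorems.AllWindowsColdBox.DirResponse (plaquettesIn_subset_product)

namespace Summit.QuantumFields.YangMills.Theorems.AllWindowsColdBoxBulkMidLine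

variable {H : ℕ}

/-! ## The logarithmic lattice sum over the plaquettes of the enlarged box, for base points of the enlarged box -/

/-- For `x ∈ {−1,…,2H+1}⁴`: `Σ_{q ∈ plaquettesIn {0..2H+2}⁴} (1 + Σ_m |x_m − (dirCorner + q).1_m|)⁻⁴ ≤ 16·(1 + 80·log(2H+3))` (the tree's
`sum_inv_pow_four_enlargedBox_le`, whose base point ranged over the cold box only, re-run for base points of the enlarged box). -/
theorem sum_inv_pow_four_plaquettes_le (x : Site 4) (hx : ∀ m, -1 ≤ x m ∧ x m ≤ 2 * (H : ℤ) + 1) :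
    ∑ q ∈ plaquettesIn (halfOpenBox 4 (2 * H + 3)),
        1 / (1 + (((∑ m : Fin 4, |x m - (Plaq.shift dirCorner q).1 m|) : ℤ) : ℝ)) ^ 4 ≤
      16 * (1 + 80 * Real.log ((((2 * H + 2 : ℕ)) : ℝ) + 1)) := by
  classical
  set f : (Fin 4 → ℤ) → ℝ := fun w => 1 / (1 + ∑ m : Fin 4, (|w m| : ℝ)) ^ 4 with hf
  have hf0 : ∀ w, 0 ≤ f w := fun w => by simp only [hf]; positivity
  set φ : Site 4 → (Fin 4 → ℤ) := fun y => y + dirCorner - x with hφ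
  have hterm : ∀ p : Plaq 4, 1 / (1 + (((∑ m : Fin 4, |x m - (Plaq.shift dirCorner p).1 m|) : ℤ) : ℝ)) ^ 4 = f (φ p.1) := by
    intro p
    simp only [hf, hφ, Plaq.shift_fst, Int.cast_sum, Int.cast_abs, Int.cast_sub, Pi.add_apply, Pi.sub_apply]
    congr 2; congr 1
    refine Finset.sum_congr rfl fun m _ => ?_
    rw [← abs_neg]; congr 1; push_cast; ring
  simp_rw [hterm]
  have h1 : ∑ p ∈ plaquettesIn (halfOpenBox 4 (2 * H + 3)), f (φ p.1) ≤
      ∑ p ∈ halfOpenBox 4 (2 * H + 3) ×ˢ ((Finset.univ : Finset (Fin 4)) ×ˢ (Finset.univ : Finset (Fin 4))), f (φ p.1) :=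
    Finset.sum_le_sum_of_subset_of_nonneg (plaquettesIn_subset_product _) fun _ _ _ => hf0 _
  refine h1.trans ?_
  rw [Finset.sum_product]
  have hconst : ∀ y : Site 4,
      ∑ _z ∈ (Finset.univ : Finset (Fin 4)) ×ˢ (Finset.univ : Finset (Fin 4)), f (φ y) = 16 * f (φ y) := fun y => by
    rw [Finset.sum_const, Finset.card_product, Finset.card_univ, Fintype.card_fin, nsmul_eq_mul]; norm_num
  simp_rw [hconst]
  rw [← Finset.mul_sum]
  refine mul_le_mul_of_nonneg_left ?_ (by norm_num)
  have hφinj : Set.InjOn φ (halfOpenBox 4 (2 * H + 3) : Set (Site 4)) := by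
    intro a _ b _ hab
    simp only [hφ] at hab
    have := congr_arg (fun w => w - dirCorner + x) hab
    simpa using this
  rw [← Finset.sum_image hφinj]
  refine (Finset.sum_le_sum_of_subset_of_nonneg ?_ fun _ _ _ => hf0 _).trans (sum_cube_inv_pow_four_le_log (2 * H + 2))
  intro w hw
  obtain ⟨y, hy, rfl⟩ := Finset.mem_image.1 hw
  rw [mem_cube]
  intro m
  have hym := (mem_halfOpenBox.1 (Finset.mem_coe.1 hy)) m
  have hxm := hx m
  simp only [hφ, Pi.add_apply, Pi.sub_apply, dirCorner]
  rw [abs_le]; push_cast; constructor <;> omega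

/-- Far keys see no free edge: if the base point of `p` is outside `{−1,…,2H+1}⁴`, then `λ_p = 0`. -/
theorem coeff_dir_eq_zero_of_far (p : Plaq 4) (hp : ¬ ∀ m, -1 ≤ p.1 m ∧ p.1 m ≤ 2 * (H : ℤ) + 1) :
    coeff (fun e => e ∉ dirFreeEdges H) dirCorner (2 * H + 3) p = 0 := by
  funext e
  obtain ⟨⟨⟨z, k⟩, hzb⟩, hzp⟩ := e
  have he : (z, k) ∈ AxialGauge.boxEdges 4 (2 * H + 1) := (mem_dirFreeEdges.1 (not_not.1 hzp)).1
  have hz : ∀ m, 0 ≤ z m ∧ z m ≤ 2 * (H : ℤ) := (mem_coldBoxEdges_iff.1 he).1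
  show coeffAux (z, k) p = 0
  apply coeffAux_eq_zero
  -- none of the four edges of `p` is `(z, k)`: their base points inherit the far coordinate of `p.1`
  have hfar : ∀ (i : Fin 4), (p.1 + Pi.single i (1 : ℤ) : Site 4) ≠ z ∧ p.1 ≠ z := by
    intro i
    constructor
    · intro h
      apply hp
      intro m
      have h1 := congr_fun h m
      simp only [Pi.add_apply, Pi.single_apply] at h1
      have := hz m
      split_ifs at h1 <;> omega
    · intro h
      apply hp
      intro m
      have h1 := congr_fun h m
      have := hz m
      omega
  rintro (h | h | h | h)
  · exact (hfar p.2.1).2 (congr_arg Prod.fst h)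
  · exact (hfar p.2.1).1 (congr_arg Prod.fst h)
  · exact (hfar p.2.2).1 (congr_arg Prod.fst h)
  · exact (hfar p.2.2).2 (congr_arg Prod.fst h)

/-- **Row sums of the Dirichlet box projection kernel**: given the dipole law with constant `c₁`, `Σ_q |K_{p, a+q}| ≤ c₁(1+log H)·16·(1+80 log(2H+3))`
for every key `p` (far keys have zero rows). -/
theorem sum_abs_boxDirProjKernel_le {c₁ : ℝ} (hc₁ : 0 ≤ c₁)
    (hK : ∀ p q : Plaq 4, |boxDirProjKernel H p q| ≤ c₁ * (1 + Real.log H) / (1 + plaqDist p q) ^ 4)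
    (hH : 1 ≤ H) (p : Plaq 4) :
    ∑ q ∈ plaquettesIn (halfOpenBox 4 (2 * H + 3)), |boxDirProjKernel H p (Plaq.shift dirCorner q)| ≤
      c₁ * (1 + Real.log H) * (16 * (1 + 80 * Real.log ((((2 * H + 2 : ℕ)) : ℝ) + 1))) := by
  have hlog : 0 ≤ 1 + Real.log H := by
    have := Real.log_nonneg (show (1 : ℝ) ≤ H by exact_mod_cast hH); linarith
  by_cases hp : ∀ m, -1 ≤ p.1 m ∧ p.1 m ≤ 2 * (H : ℤ) + 1
  · calc ∑ q ∈ plaquettesIn (halfOpenBox 4 (2 * H + 3)), |boxDirProjKernel H p (Plaq.shift dirCorner q)|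
        ≤ ∑ q ∈ plaquettesIn (halfOpenBox 4 (2 * H + 3)),
            c₁ * (1 + Real.log H) * (1 / (1 + (((∑ m : Fin 4, |p.1 m - (Plaq.shift dirCorner q).1 m|) : ℤ) : ℝ)) ^ 4) := by
          refine Finset.sum_le_sum fun q _ => ?_
          rw [mul_one_div]
          exact hK p (Plaq.shift dirCorner q)
      _ = c₁ * (1 + Real.log H) * ∑ q ∈ plaquettesIn (halfOpenBox 4 (2 * H + 3)),
            1 / (1 + (((∑ m : Fin 4, |p.1 m - (Plaq.shift dirCorner q).1 m|) : ℤ) : ℝ)) ^ 4 := by rw [Finset.mul_sum]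
      _ ≤ c₁ * (1 + Real.log H) * (16 * (1 + 80 * Real.log ((((2 * H + 2 : ℕ)) : ℝ) + 1))) :=
          mul_le_mul_of_nonneg_left (sum_inv_pow_four_plaquettes_le p.1 hp) (by positivity)
  · have h0 : ∀ q : Plaq 4, boxDirProjKernel H p q = 0 := fun q => by
      rw [boxDirProjKernel, coeff_dir_eq_zero_of_far p hp, zero_dotProduct]
    simp only [h0, abs_zero, Finset.sum_const_zero]
    have h5 : 0 ≤ Real.log ((((2 * H + 2 : ℕ)) : ℝ) + 1) := Real.log_nonneg (by push_cast; linarith)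
    positivity

/-! ## The stub, by name -/

/-- **Stub K3′ of LINE-18 (`stub_harmonicMaxPrincipleFlux`), BY NAME** — `DirHarmonicMaxPrincipleFlux` as registered (see the module docstring for
what this statement does and does not say). -/
theorem stub_harmonicMaxPrincipleFlux : DirHarmonicMaxPrincipleFlux := by
  obtain ⟨c₁, hc₁, hK1⟩ := stub_kernelDipoleDecay
  refine ⟨144 * (1 + 5136 * c₁) ^ 2, by positivity, fun H hH ϑ B hB p => ?_⟩
  have hH' : (1 : ℝ) ≤ H := by exact_mod_cast hH
  have hlog0 : 0 ≤ Real.log H := Real.log_nonneg hH'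
  obtain ⟨hB0, hsqB⟩ := hypB_nonneg_and_sq_sqrt hB
  have hsq : 0 ≤ Real.sqrt B := Real.sqrt_nonneg B
  -- the admissible competitor with small circulations
  obtain ⟨s, hs⟩ := exists_dirFree_sCirc_glue_abs_le hH hB
  -- `|F̄_p| ≤ |c_p| + Σ_q |K| |c|`
  have h1 := abs_dirBackground_le_abs_add_sum H ϑ s p
  -- row sum of the kernel
  have hrow := sum_abs_boxDirProjKernel_le hc₁.le (hK1 H hH) hH p
  have hlog : Real.log ((((2 * H + 2 : ℕ)) : ℝ) + 1) ≤ 4 + Real.log H := by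
    have hH0 : (0 : ℝ) < H := by linarith
    have h5 : Real.log 5 ≤ 4 := by
      have := Real.log_le_sub_one_of_pos (by norm_num : (0 : ℝ) < 5); linarith
    calc Real.log ((((2 * H + 2 : ℕ)) : ℝ) + 1) ≤ Real.log (5 * H) := by
          apply Real.log_le_log (by positivity); push_cast; linarith
      _ = Real.log 5 + Real.log H := Real.log_mul (by norm_num) hH0.ne'
      _ ≤ 4 + Real.log H := by linarith
  have hrow' : ∑ q ∈ plaquettesIn (halfOpenBox 4 (2 * H + 3)), |boxDirProjKernel H p (Plaq.shift dirCorner q)| ≤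
      5136 * c₁ * (1 + Real.log H) ^ 2 := by
    refine hrow.trans ?_
    have : 16 * (1 + 80 * Real.log ((((2 * H + 2 : ℕ)) : ℝ) + 1)) ≤ 5136 * (1 + Real.log H) := by nlinarith
    calc c₁ * (1 + Real.log H) * (16 * (1 + 80 * Real.log ((((2 * H + 2 : ℕ)) : ℝ) + 1)))
        ≤ c₁ * (1 + Real.log H) * (5136 * (1 + Real.log H)) := mul_le_mul_of_nonneg_left this (by positivity)
      _ = 5136 * c₁ * (1 + Real.log H) ^ 2 := by ring
  -- the sum `Σ_q |K| |c| ≤ 12√B · Σ_q |K|`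
  have h2 : ∑ q ∈ plaquettesIn (halfOpenBox 4 (2 * H + 3)),
      |boxDirProjKernel H p (Plaq.shift dirCorner q)| *
        |sCirc (LatticeMaxwell.glue (pin := fun e => e ∉ dirFreeEdges H) dirCorner (2 * H + 3) ϑ s) (Plaq.shift dirCorner q)| ≤
      (5136 * c₁ * (1 + Real.log H) ^ 2) * (12 * Real.sqrt B) := by
    calc ∑ q ∈ plaquettesIn (halfOpenBox 4 (2 * H + 3)),
          |boxDirProjKernel H p (Plaq.shift dirCorner q)| *
            |sCirc (LatticeMaxwell.glue (pin := fun e => e ∉ dirFreeEdges H) dirCorner (2 * H + 3) ϑ s) (Plaq.shift dirCorner q)|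
        ≤ ∑ q ∈ plaquettesIn (halfOpenBox 4 (2 * H + 3)), |boxDirProjKernel H p (Plaq.shift dirCorner q)| * (12 * Real.sqrt B) :=
          Finset.sum_le_sum fun q _ => mul_le_mul_of_nonneg_left (hs _) (abs_nonneg _)
      _ = (∑ q ∈ plaquettesIn (halfOpenBox 4 (2 * H + 3)), |boxDirProjKernel H p (Plaq.shift dirCorner q)|) * (12 * Real.sqrt B) := by
          rw [Finset.sum_mul]
      _ ≤ (5136 * c₁ * (1 + Real.log H) ^ 2) * (12 * Real.sqrt B) := mul_le_mul_of_nonneg_right hrow' (by positivity)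
  -- `|F̄_p| ≤ 12√B (1 + 5136 c₁)(1 + log H)²`
  have h3 : |sCirc (LatticeMaxwell.glue (pin := fun e => e ∉ dirFreeEdges H) dirCorner (2 * H + 3) ϑ
      (mean (fun e => e ∉ dirFreeEdges H) dirCorner (2 * H + 3) ϑ)) p| ≤
      12 * Real.sqrt B * ((1 + 5136 * c₁) * (1 + Real.log H) ^ 2) := by
    have hsp := hs p
    have hsq1 : (1 : ℝ) ≤ (1 + Real.log H) ^ 2 := by nlinarith
    nlinarith [h1, h2, hsp, hsq, hc₁.le]
  -- square
  have hM : 0 ≤ 12 * Real.sqrt B * ((1 + 5136 * c₁) * (1 + Real.log H) ^ 2) := by positivity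
  have h4 := pow_le_pow_left₀ (abs_nonneg _) h3 2
  rw [sq_abs] at h4
  refine h4.trans (le_of_eq ?_)
  rw [show (12 * Real.sqrt B * ((1 + 5136 * c₁) * (1 + Real.log H) ^ 2)) ^ 2 =
      144 * (1 + 5136 * c₁) ^ 2 * (1 + Real.log H) ^ 4 * Real.sqrt B ^ 2 by ring, hsqB]

/-- v3's K3 (`DirHarmonicMaxPrinciple`, the same conclusion from the bound on ALL circulations of `glue ϑ 0`) holds: it is the one-line weakening
of K3′ (appended 2026-08-30; same honest label as `stub_harmonicMaxPrincipleFlux`). -/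
theorem dirHarmonicMaxPrinciple_holds : DirHarmonicMaxPrinciple :=
  dirHarmonicMaxPrinciple_of_flux stub_harmonicMaxPrincipleFlux

end Summit.QuantumFields.YangMills.Theorems.AllWindowsColdBoxBulkMidLine

end
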